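import Summits.KontsevichZagierPeriods.KontsevichZagierPeriods.Theorems.SymplecticScissorsRealOnePeriodRelationsStubHomotopyInvarianceAux2
import Summits.KontsevichZagierPeriods.KontsevichZagierPeriods.Theorems.SymplecticScissorsRealOnePeriodRelationsStubHomotopyInvarianceAux4
import Summits.KontsevichZagierPeriods.KontsevichZagierPeriods.Theorems.SymplecticScissorsRealOnePeriodRelationsStubSaChart
import Summits.KontsevichZagierPeriods.KontsevichZagierPeriods.Theorems.SymplecticScissorsRealOnePeriodRelationsStubSaPathSubset
import Summits.KontsevichZagierPeriods.KontsevichZagierPeriods.Theorems.SymplecticScissorsRealOnePeriodRelationsStubCellGreen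
import Summits.KontsevichZagierPeriods.KontsevichZagierPeriods.Theorems.SymplecticScissorsRealOnePeriodRelationsStubGreenOnSquare

/-!
# `RealOnePeriodRelations` (stmt-KontsevichZagierPeriods-10042), line `nash-retraction-thin-strip`:
# stub `stub_homotopyInvariance` — homotopy coherence in the move world

Two `ℚ`-semialgebraic `C¹` paths `γ₀, γ₁` with algebraic end points on a smooth affine curve `Z`
over `ℚ̄` which are homotopic with fixed end points inside `Z(ℂ)` realise `a · ω`
(`[∫₀¹ Re(a · Σᵢ ωᵢ(γ) γᵢ′) dt]`) equally modulo
`M₁ = closure (domainAddRel ∪ integrandAddRel ∪ changeOfVariablesRel ∪ Green)`, for every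
polynomial form `ω` over `ℚ̄` and algebraic scalar `a` — given the three neighbouring stubs as
hypotheses: semialgebraic graph charts (`stub_saChart`), semialgebraic `C¹` replacement of
continuous paths inside open sets (`stub_saPathSubset`) and the chart cell (`stub_cellGreen`).

Proof: grid of `N × N` cells inside single semialgebraic charts (Lebesgue number), algebraic vertices and
semialgebraic `C¹` edges, one chart cell per cell, telescoping in `M₁`, rule 1a at the cut points and affine
rule 2.  `homotopyInvariance_holds` is the unconditional corollary (registered anchor).

References: A. Huber, G. Wüstholz, *Transcendence and Linear Relations of 1-Periods* (CUP 2022),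
§3.3.1, Thm. 13.3 (2); M. Kontsevich, D. Zagier, *Periods* (2001), §1.2.
-/

noncomputable section

open scoped BigOperators Topology unitInterval
open Set MeasureTheory Filter
open Literature.NumberTheory.Transcendental Literature.NumberTheory.Transcendental.CurvePeriods
open Literature.ModelTheory.ExponentialFields (IsSemialgebraic)
open Summit.KontsevichZagierPeriods.SymplecticScissors.RealOnePeriodRelationsNegative (M₁ unitDom)
open Summit.KontsevichZagierPeriods.Theorems.StuffleInKZ.Negative.LogShadow (isSemialgebraic_Icc01)

namespace Summit.KontsevichZagierPeriods.SymplecticScissors.RealOnePeriodRelations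

open HomotopyInvariance

/-- **STUB `stub_homotopyInvariance` — HOMOTOPY COHERENCE IN THE MOVE WORLD.** Given semialgebraic
graph charts (`stub_saChart`), semialgebraic `C¹` replacement of continuous paths inside open sets
(`stub_saPathSubset`) and the chart cell (`stub_cellGreen`), two `ℚ`-semialgebraic `C¹` paths
`γ₀, γ₁` on a smooth affine curve `Z` over `ℚ̄` which are homotopic with fixed end points inside
`Z(ℂ)` realise `a · ω` equally modulo `M₁`, for every polynomial form `ω` over `ℚ̄` and algebraic
`a` (grid of chart cells, algebraic vertices, semialgebraic `C¹` edges, one chart cell per cell,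
telescoping, sides = sums of grid pieces; see the module docstring).
[cite: HuberWustholz2022, §3.3.1] -/
theorem stub_homotopyInvariance :
    (∀ (Z : CurveData), Z.IsSmoothAffineCurve → ∀ z₀ ∈ Z.points,
      ∃ (i₀ : Fin Z.n) (c : ℂ) (ε ρ : ℝ) (Ω : Set (Fin Z.n → ℂ)) (ψ : ℂ → (Fin Z.n → ℂ)),
        0 < ρ ∧ ρ < ε ∧ IsOpen Ω ∧ z₀ ∈ Ω ∧ z₀ i₀ ∈ Metric.ball c (ρ / 6) ∧ AnalyticOnNhd ℂ ψ (Metric.ball c ε) ∧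
        (∀ z ∈ Ω, z ∈ Z.points → z i₀ ∈ Metric.ball c ε ∧ ψ (z i₀) = z) ∧
        (∀ w ∈ Metric.ball c ε, ψ w ∈ Ω ∧ ψ w ∈ Z.points ∧ ψ w i₀ = w) ∧
        IsSemialgebraicMapOn ℚ {q : Fin 2 → ℝ | (⟨q 0, q 1⟩ : ℂ) ∈ Metric.closedBall c ρ}
          (fun q => Fin.append (fun i => (ψ ⟨q 0, q 1⟩ i).re) (fun i => (ψ ⟨q 0, q 1⟩ i).im))) →
    (∀ (Z : CurveData), Z.IsSmoothAffineCurve → ∀ (G : Set (Fin Z.n → ℂ)), IsOpen G →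
      ∀ (e : ℝ → (Fin Z.n → ℂ)), ContinuousOn e (Set.Icc 0 1) →
        (∀ t ∈ Set.Icc (0 : ℝ) 1, e t ∈ Z.points) → (∀ t ∈ Set.Icc (0 : ℝ) 1, e t ∈ G) →
        (∀ i, IsAlgebraic ℚ (e 0 i)) → (∀ i, IsAlgebraic ℚ (e 1 i)) →
      ∃ γ : CurvePath Z,
        IsSemialgebraicMapOn ℚ {z : Fin 1 → ℝ | z 0 ∈ Set.Icc (0 : ℝ) 1}
          (fun z => Fin.append (fun i => (γ.toFun (z 0) i).re) (fun i => (γ.toFun (z 0) i).im)) ∧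
        γ.toFun 0 = e 0 ∧ γ.toFun 1 = e 1 ∧ ∀ t ∈ Set.Icc (0 : ℝ) 1, γ.toFun t ∈ G) →
    (∀ (n : ℕ) (ω : Fin n → MvPolynomial (Fin n) ℂ), (∀ i, HasAlgCoeffs (ω i)) →
      ∀ (a : ℂ), IsAlgebraic ℚ a →
      ∀ (c : ℂ) (ε ρ : ℝ) (ψ : ℂ → (Fin n → ℂ)), 0 < ρ → ρ < ε → AnalyticOnNhd ℂ ψ (Metric.ball c ε) →
        IsSemialgebraicMapOn ℚ {q : Fin 2 → ℝ | (⟨q 0, q 1⟩ : ℂ) ∈ Metric.closedBall c ρ}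
          (fun q => Fin.append (fun i => (ψ ⟨q 0, q 1⟩ i).re) (fun i => (ψ ⟨q 0, q 1⟩ i).im)) →
      ∀ (wb wr wt wl : ℝ → ℂ),
        ContDiffOn ℝ 1 wb (Set.Icc 0 1) → ContDiffOn ℝ 1 wr (Set.Icc 0 1) →
        ContDiffOn ℝ 1 wt (Set.Icc 0 1) → ContDiffOn ℝ 1 wl (Set.Icc 0 1) →
        IsSemialgebraicMapOn ℚ {z : Fin 1 → ℝ | z 0 ∈ Set.Icc (0 : ℝ) 1} (fun z => ![(wb (z 0)).re, (wb (z 0)).im]) →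
        IsSemialgebraicMapOn ℚ {z : Fin 1 → ℝ | z 0 ∈ Set.Icc (0 : ℝ) 1} (fun z => ![(wr (z 0)).re, (wr (z 0)).im]) →
        IsSemialgebraicMapOn ℚ {z : Fin 1 → ℝ | z 0 ∈ Set.Icc (0 : ℝ) 1} (fun z => ![(wt (z 0)).re, (wt (z 0)).im]) →
        IsSemialgebraicMapOn ℚ {z : Fin 1 → ℝ | z 0 ∈ Set.Icc (0 : ℝ) 1} (fun z => ![(wl (z 0)).re, (wl (z 0)).im]) →
        (∀ t ∈ Set.Icc (0 : ℝ) 1, wb t ∈ Metric.closedBall c (ρ / 4)) →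
        (∀ t ∈ Set.Icc (0 : ℝ) 1, wr t ∈ Metric.closedBall c (ρ / 4)) →
        (∀ t ∈ Set.Icc (0 : ℝ) 1, wt t ∈ Metric.closedBall c (ρ / 4)) →
        (∀ t ∈ Set.Icc (0 : ℝ) 1, wl t ∈ Metric.closedBall c (ρ / 4)) →
        wb 0 = wl 0 → wb 1 = wr 0 → wr 1 = wt 1 → wl 1 = wt 0 →
      ∀ (rb rr rt rl : KZ.IntegralRep 1),
        (rb.domain = {z | z 0 ∈ Set.Ioo (0 : ℝ) 1} ∧ ∀ z ∈ rb.domain, rb.integrand z =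
          (a * ∑ i, MvPolynomial.eval (ψ (wb (z 0))) (ω i) * deriv (fun u => ψ (wb u) i) (z 0)).re) →
        (rr.domain = {z | z 0 ∈ Set.Ioo (0 : ℝ) 1} ∧ ∀ z ∈ rr.domain, rr.integrand z =
          (a * ∑ i, MvPolynomial.eval (ψ (wr (z 0))) (ω i) * deriv (fun u => ψ (wr u) i) (z 0)).re) →
        (rt.domain = {z | z 0 ∈ Set.Ioo (0 : ℝ) 1} ∧ ∀ z ∈ rt.domain, rt.integrand z =
          (a * ∑ i, MvPolynomial.eval (ψ (wt (z 0))) (ω i) * deriv (fun u => ψ (wt u) i) (z 0)).re) →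
        (rl.domain = {z | z 0 ∈ Set.Ioo (0 : ℝ) 1} ∧ ∀ z ∈ rl.domain, rl.integrand z =
          (a * ∑ i, MvPolynomial.eval (ψ (wl (z 0))) (ω i) * deriv (fun u => ψ (wl u) i) (z 0)).re) →
        KZ.of rb + KZ.of rr - KZ.of rt - KZ.of rl ∈ M₁) →
    ∀ (Z : CurveData) (hZ : Z.IsSmoothAffineCurve) (ω : Fin Z.n → MvPolynomial (Fin Z.n) ℂ),
      (∀ i, HasAlgCoeffs (ω i)) → ∀ (a : ℂ), IsAlgebraic ℚ a →
    ∀ (γ₀ γ₁ : CurvePath Z),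
      IsSemialgebraicMapOn ℚ {z : Fin 1 → ℝ | z 0 ∈ Set.Icc (0 : ℝ) 1}
        (fun z => Fin.append (fun i => (γ₀.toFun (z 0) i).re) (fun i => (γ₀.toFun (z 0) i).im)) →
      IsSemialgebraicMapOn ℚ {z : Fin 1 → ℝ | z 0 ∈ Set.Icc (0 : ℝ) 1}
        (fun z => Fin.append (fun i => (γ₁.toFun (z 0) i).re) (fun i => (γ₁.toFun (z 0) i).im)) →
      (∃ (x y : Z.points) (p₀ p₁ : Path x y), (∀ t : I, γ₀.toFun t = p₀ t) ∧ (∀ t : I, γ₁.toFun t = p₁ t) ∧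
        p₀.Homotopic p₁) →
    ∀ (r₀ r₁ : KZ.IntegralRep 1),
      (r₀.domain = {z | z 0 ∈ Set.Ioo (0 : ℝ) 1} ∧ ∀ z ∈ r₀.domain, r₀.integrand z =
        (a * ∑ i, MvPolynomial.eval (γ₀.toFun (z 0)) (ω i) * deriv (fun u => γ₀.toFun u i) (z 0)).re) →
      (r₁.domain = {z | z 0 ∈ Set.Ioo (0 : ℝ) 1} ∧ ∀ z ∈ r₁.domain, r₁.integrand z =
        (a * ∑ i, MvPolynomial.eval (γ₁.toFun (z 0)) (ω i) * deriv (fun u => γ₁.toFun u i) (z 0)).re) →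
      KZ.of r₀ - KZ.of r₁ ∈ M₁ := by
  intro hChart hPath hCell Z hZ ω hω a ha γ₀ γ₁ hγ₀sa hγ₁sa hhom r₀ r₁ hr₀ hr₁
  classical
  obtain ⟨x, y, p₀, p₁, hp₀, hp₁, hp⟩ := hhom
  obtain ⟨H, hHc, hHZ', hH0, hH1, hγ₀, hγ₁⟩ := exists_continuousHomotopy hp γ₀ γ₁ hp₀ hp₁
  have hH : ContinuousOn H (Icc (0 : ℝ) 1 ×ˢ Icc (0 : ℝ) 1) := hHc.continuousOn
  have hHZ : ∀ q ∈ Icc (0 : ℝ) 1 ×ˢ Icc (0 : ℝ) 1, H q ∈ Z.points := fun q _ => hHZ' q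
  have hI0 : (0 : ℝ) ∈ Icc (0 : ℝ) 1 := ⟨le_rfl, zero_le_one⟩
  have hI1 : (1 : ℝ) ∈ Icc (0 : ℝ) 1 := ⟨zero_le_one, le_rfl⟩
  -- the end points
  set P : Fin Z.n → ℂ := H (0, 0) with hP
  set Q : Fin Z.n → ℂ := H (0, 1) with hQ
  have hP0 : γ₀.toFun 0 = P := hγ₀ 0 hI0
  have hQ0 : γ₀.toFun 1 = Q := hγ₀ 1 hI1
  have hP1 : γ₁.toFun 0 = P := (hγ₁ 0 hI0).trans (hH0 1)
  have hQ1 : γ₁.toFun 1 = Q := (hγ₁ 1 hI1).trans (hH1 1)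
  have hPZ : P ∈ Z.points := hP0 ▸ γ₀.mem_points 0 hI0
  have hQZ : Q ∈ Z.points := hQ0 ▸ γ₀.mem_points 1 hI1
  have hPa : ∀ i, IsAlgebraic ℚ (P i) := fun i => hP0 ▸ γ₀.algebraic_zero i
  have hQa : ∀ i, IsAlgebraic ℚ (Q i) := fun i => hQ0 ▸ γ₀.algebraic_one i
  haveI : Nonempty (Fin Z.n) := ⟨⟨0, Nat.pos_of_ne_zero (n_ne_zero_of_mem hZ hPZ)⟩⟩
  haveI : Nonempty (KZ.IntegralRep 1) := ⟨r₀⟩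
  -- Step 1: semialgebraic charts at the points of `Z`, their regions, the grid
  choose! ι cc εc ρc Ωc ψc hρc hρε hΩo hzΩ hzb hψan h1c h2c hψsa using hChart Z hZ
  let Rg : (Fin Z.n → ℂ) → Set (Fin Z.n → ℂ) := fun z =>
    Ωc z ∩ {z' | z' (ι z) ∈ Metric.ball (cc z) (ρc z / 4)}
  have hRgo : ∀ z ∈ Z.points, IsOpen (Rg z) := fun z hz =>
    (hΩo z hz).inter (Metric.isOpen_ball.preimage (continuous_apply (ι z)))
  have hzRg : ∀ z ∈ Z.points, z ∈ Rg z := fun z hz =>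
    ⟨hzΩ z hz, Metric.ball_subset_ball (by linarith [hρc z hz]) (hzb z hz)⟩
  obtain ⟨N, zc, hN, hgrid⟩ := exists_grid hH hHZ Rg hRgo hzRg
  have hN' : (0 : ℝ) < N := by exact_mod_cast hN
  -- regions of the cells, extended by `univ` outside the grid
  let Rx : ℕ → ℕ → Set (Fin Z.n → ℂ) := fun p q => if p < N ∧ q < N then Rg (zc p q) else univ
  have hRx_eq : ∀ p q, p < N → q < N → Rx p q = Rg (zc p q) := fun p q hp hq => if_pos ⟨hp, hq⟩
  have hRxo : ∀ p q, IsOpen (Rx p q) := by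
    intro p q
    by_cases hpq : p < N ∧ q < N
    · rw [show Rx p q = Rg (zc p q) from if_pos hpq]; exact hRgo _ (hgrid p q hpq.1 hpq.2).1
    · rw [show Rx p q = univ from if_neg hpq]; exact isOpen_univ
  have hRxc : ∀ p q x, x ∈ gridCell N p q → x ∈ Icc (0 : ℝ) 1 ×ˢ Icc (0 : ℝ) 1 → H x ∈ Rx p q := by
    intro p q x hx hxK
    by_cases hpq : p < N ∧ q < N
    · rw [show Rx p q = Rg (zc p q) from if_pos hpq]; exact (hgrid p q hpq.1 hpq.2).2 x hx
    · rw [show Rx p q = univ from if_neg hpq]; exact mem_univ _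
  -- Step 2: the vertices `A p q` and the semialgebraic `C¹` edges `eH`, `eV`
  -- values of the old vertices `v p q = H(p/N, q/N)` on the boundary
  have hv0q : ∀ q, q ≤ N → H (((0 : ℕ) : ℝ) / N, (q : ℝ) / N) = γ₀.toFun ((q : ℝ) / N) :=
    fun q hq => by rw [Nat.cast_zero, zero_div]; exact (hγ₀ _ (div_mem_Icc hN hq)).symm
  have hvNq : ∀ q, q ≤ N → H ((N : ℝ) / N, (q : ℝ) / N) = γ₁.toFun ((q : ℝ) / N) :=
    fun q hq => by rw [div_self hN'.ne']; exact (hγ₁ _ (div_mem_Icc hN hq)).symm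
  have hv0 : ∀ p : ℕ, H ((p : ℝ) / N, ((0 : ℕ) : ℝ) / N) = P := fun p => by
    rw [Nat.cast_zero, zero_div]; exact hH0 _
  have hvN : ∀ p : ℕ, H ((p : ℝ) / N, (N : ℝ) / N) = Q := fun p => by
    rw [div_self hN'.ne']; exact hH1 _
  -- the grid values of the side paths are algebraic (semialgebraic paths at rational times)
  have halg₀ : ∀ q, q ≤ N → ∀ i, IsAlgebraic ℚ (γ₀.toFun ((q : ℝ) / N) i) := fun q hq i => by
    have h' := isAlgebraic_apply_of_sa hγ₀sa (q := (q : ℚ) / N)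
      (by push_cast; exact div_mem_Icc hN hq) i
    push_cast at h'
    exact h'
  have halg₁ : ∀ q, q ≤ N → ∀ i, IsAlgebraic ℚ (γ₁.toFun ((q : ℝ) / N) i) := fun q hq i => by
    have h' := isAlgebraic_apply_of_sa hγ₁sa (q := (q : ℚ) / N)
      (by push_cast; exact div_mem_Icc hN hq) i
    push_cast at h'
    exact h'
  have hvalg : ∀ p q, p ≤ N → q ≤ N → (p = 0 ∨ N ≤ p ∨ q = 0 ∨ N ≤ q) →
      ∀ i, IsAlgebraic ℚ (H ((p : ℝ) / N, (q : ℝ) / N) i) := by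
    intro p q hp hq hbd i
    rcases hbd with h0 | hNp | h0 | hNq
    · rw [h0, hv0q q hq]; exact halg₀ q hq i
    · rw [le_antisymm hp hNp, hvNq q hq]; exact halg₁ q hq i
    · rw [h0, hv0]; exact hPa i
    · rw [le_antisymm hq hNq, hvN]; exact hQa i
  obtain ⟨A, eH, eV, hA_bd, hEH, hEV⟩ :=
    exists_grid_edges hZ (hPath Z hZ) hHc hHZ' hN Rx hRxo hRxc hvalg
  have hvK : ∀ p q, p ≤ N → q ≤ N → ((p : ℝ) / N, (q : ℝ) / N) ∈ Icc (0 : ℝ) 1 ×ˢ Icc (0 : ℝ) 1 :=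
    fun p q hp hq => ⟨div_mem_Icc hN hp, div_mem_Icc hN hq⟩
  have hcorner : ∀ p q p' q', (p' = p - 1 ∨ p' = p) → (q' = q - 1 ∨ q' = q) →
      ((p : ℝ) / N, (q : ℝ) / N) ∈ gridCell N p' q' := fun p q p' q' hp' hq' =>
    mem_gridCell_of hN (cast_le_and_le_of_pred_or_eq hp').1 (cast_le_and_le_of_pred_or_eq hp').2
      (cast_le_and_le_of_pred_or_eq hq').1 (cast_le_and_le_of_pred_or_eq hq').2
  -- boundary values of `A`
  have hA0q : ∀ q, q ≤ N → A 0 q = γ₀.toFun ((q : ℝ) / N) := fun q hq => by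
    rw [hA_bd 0 q (Or.inl rfl)]; exact hv0q q hq
  have hANq : ∀ q, q ≤ N → A N q = γ₁.toFun ((q : ℝ) / N) := fun q hq => by
    rw [hA_bd N q (Or.inr (Or.inl le_rfl))]; exact hvNq q hq
  have hAp0 : ∀ p, A p 0 = P := fun p => by
    rw [hA_bd p 0 (Or.inr (Or.inr (Or.inl rfl)))]; exact hv0 p
  have hApN : ∀ p, A p N = Q := fun p => by
    rw [hA_bd p N (Or.inr (Or.inr (Or.inr le_rfl)))]; exact hvN p
  -- Step 5: the edge families of the grid and their realisations
  let cP : CurvePath Z := CurvePath.const P hPZ hPa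
  let cQ : CurvePath Z := CurvePath.const Q hQZ hQa
  let eh : ℕ → ℕ → CurvePath Z := fun p q => if q = 0 then cP else if N ≤ q then cQ else eH p q
  let ev : ℕ → ℕ → CurvePath Z := fun p q =>
    if p = 0 then γ₀.gridPiece N hN halg₀ q else if N ≤ p then γ₁.gridPiece N hN halg₁ q else eV p q
  have heh_zero : ∀ p, eh p 0 = cP := fun p => if_pos rfl
  have heh_N : ∀ p q, q ≠ 0 → N ≤ q → eh p q = cQ := fun p q h0 hq => by
    show (if q = 0 then cP else if N ≤ q then cQ else eH p q) = cQ
    rw [if_neg h0, if_pos hq]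
  have heh_mid : ∀ p q, 0 < q → q < N → eh p q = eH p q := fun p q h0 hq => by
    show (if q = 0 then cP else if N ≤ q then cQ else eH p q) = eH p q
    rw [if_neg (Nat.pos_iff_ne_zero.mp h0), if_neg (not_le.mpr hq)]
  have hev_zero : ∀ q, ev 0 q = γ₀.gridPiece N hN halg₀ q := fun q => if_pos rfl
  have hev_N : ∀ q, ev N q = γ₁.gridPiece N hN halg₁ q := fun q => by
    show (if N = 0 then γ₀.gridPiece N hN halg₀ q else
      if N ≤ N then γ₁.gridPiece N hN halg₁ q else eV N q) = _
    rw [if_neg hN.ne', if_pos le_rfl]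
  have hev_mid : ∀ p q, 0 < p → p < N → ev p q = eV p q := fun p q h0 hp => by
    show (if p = 0 then γ₀.gridPiece N hN halg₀ q else
      if N ≤ p then γ₁.gridPiece N hN halg₁ q else eV p q) = eV p q
    rw [if_neg (Nat.pos_iff_ne_zero.mp h0), if_neg (not_le.mpr hp)]
  have hcases : ∀ q, q ≤ N → q = 0 ∨ (0 < q ∧ q < N) ∨ (q ≠ 0 ∧ N ≤ q ∧ q = N) := by
    intro q hq
    rcases Nat.eq_zero_or_pos q with h0 | h0
    · exact Or.inl h0
    · rcases Nat.lt_or_ge q N with h1 | h1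
      · exact Or.inr (Or.inl ⟨h0, h1⟩)
      · exact Or.inr (Or.inr ⟨by omega, h1, le_antisymm hq h1⟩)
  have hpiece₀ : ∀ q, q < N → (γ₀.gridPiece N hN halg₀ q).toFun =
      fun t => γ₀.toFun ((q : ℝ) / N + t / N) := fun q hq =>
    funext fun t => CurvePath.gridPiece_apply γ₀ N hN halg₀ hq t
  have hpiece₁ : ∀ q, q < N → (γ₁.gridPiece N hN halg₁ q).toFun =
      fun t => γ₁.toFun ((q : ℝ) / N + t / N) := fun q hq =>
    funext fun t => CurvePath.gridPiece_apply γ₁ N hN halg₁ hq t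
  -- the edges are semialgebraic
  have hsah : ∀ p q, p < N → q ≤ N → IsSemialgebraicMapOn ℚ {z : Fin 1 → ℝ | z 0 ∈ Set.Icc (0 : ℝ) 1}
      (fun z => Fin.append (fun i => ((eh p q).toFun (z 0) i).re)
        (fun i => ((eh p q).toFun (z 0) i).im)) := by
    intro p q hp hq
    rcases hcases q hq with h0 | ⟨h0, h1⟩ | ⟨h0, h1, _⟩
    · rw [h0, heh_zero]; exact sa_const hPa
    · rw [heh_mid p q h0 h1]; exact (hEH p q ⟨hp, h0, h1⟩).1
    · rw [heh_N p q h0 h1]; exact sa_const hQa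
  have hsav : ∀ p q, p ≤ N → q < N → IsSemialgebraicMapOn ℚ {z : Fin 1 → ℝ | z 0 ∈ Set.Icc (0 : ℝ) 1}
      (fun z => Fin.append (fun i => ((ev p q).toFun (z 0) i).re)
        (fun i => ((ev p q).toFun (z 0) i).im)) := by
    intro p q hp hq
    rcases hcases p hp with h0 | ⟨h0, h1⟩ | ⟨_, _, h2⟩
    · rw [h0, hev_zero, hpiece₀ q hq]; exact sa_piece hγ₀sa hN hq
    · rw [hev_mid p q h0 h1]; exact (hEV p q ⟨h0, h1, hq⟩).1
    · rw [h2, hev_N, hpiece₁ q hq]; exact sa_piece hγ₁sa hN hq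
  -- realisations of the edges
  have hreph : ∀ p q, p < N ∧ q ≤ N → ∃ R : KZ.IntegralRep 1,
      R.domain = {z | z 0 ∈ Set.Ioo (0 : ℝ) 1} ∧ ∀ z ∈ R.domain, R.integrand z =
        (a * ∑ i, MvPolynomial.eval ((eh p q).toFun (z 0)) (ω i) *
          deriv (fun u => (eh p q).toFun u i) (z 0)).re :=
    fun p q hpq => exists_realisesRep ω hω ha (eh p q).contDiffOn (hsah p q hpq.1 hpq.2)
  have hrepv : ∀ p q, p ≤ N ∧ q < N → ∃ R : KZ.IntegralRep 1,
      R.domain = {z | z 0 ∈ Set.Ioo (0 : ℝ) 1} ∧ ∀ z ∈ R.domain, R.integrand z =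
        (a * ∑ i, MvPolynomial.eval ((ev p q).toFun (z 0)) (ω i) *
          deriv (fun u => (ev p q).toFun u i) (z 0)).re :=
    fun p q hpq => exists_realisesRep ω hω ha (ev p q).contDiffOn (hsav p q hpq.1 hpq.2)
  choose! Rh hRh using hreph
  choose! Rv hRv using hrepv
  -- Step 6: end points and positions of the edges
  have Heh0 : ∀ p q, p < N → q ≤ N → (eh p q).toFun 0 = A p q := by
    intro p q hp hq
    rcases hcases q hq with h0 | ⟨h0, h1⟩ | ⟨h0, h1, h2⟩
    · rw [h0, heh_zero, hAp0]; rfl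
    · rw [heh_mid p q h0 h1]; exact (hEH p q ⟨hp, h0, h1⟩).2.1
    · rw [heh_N p q h0 h1, h2, hApN]; rfl
  have Heh1 : ∀ p q, p < N → q ≤ N → (eh p q).toFun 1 = A (p + 1) q := by
    intro p q hp hq
    rcases hcases q hq with h0 | ⟨h0, h1⟩ | ⟨h0, h1, h2⟩
    · rw [h0, heh_zero, hAp0]; rfl
    · rw [heh_mid p q h0 h1]; exact (hEH p q ⟨hp, h0, h1⟩).2.2.1
    · rw [heh_N p q h0 h1, h2, hApN]; rfl
  have hcast1 : ∀ q : ℕ, (q : ℝ) / N + 1 / N = ((q + 1 : ℕ) : ℝ) / N := fun q => by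
    push_cast; ring
  have Hev0 : ∀ p q, p ≤ N → q < N → (ev p q).toFun 0 = A p q := by
    intro p q hp hq
    rcases hcases p hp with h0 | ⟨h0, h1⟩ | ⟨_, _, h2⟩
    · rw [h0, hev_zero, CurvePath.gridPiece_apply _ _ _ _ hq, zero_div, add_zero, hA0q q hq.le]
    · rw [hev_mid p q h0 h1]; exact (hEV p q ⟨h0, h1, hq⟩).2.1
    · rw [h2, hev_N, CurvePath.gridPiece_apply _ _ _ _ hq, zero_div, add_zero, hANq q hq.le]
  have Hev1 : ∀ p q, p ≤ N → q < N → (ev p q).toFun 1 = A p (q + 1) := by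
    intro p q hp hq
    rcases hcases p hp with h0 | ⟨h0, h1⟩ | ⟨_, _, h2⟩
    · rw [h0, hev_zero, CurvePath.gridPiece_apply _ _ _ _ hq, hcast1, hA0q (q + 1) hq]
    · rw [hev_mid p q h0 h1]; exact (hEV p q ⟨h0, h1, hq⟩).2.2.1
    · rw [h2, hev_N, CurvePath.gridPiece_apply _ _ _ _ hq, hcast1, hANq (q + 1) hq]
  have Hb : ∀ p q, p < N → q < N → ∀ t ∈ Icc (0 : ℝ) 1, (eh p q).toFun t ∈ Rg (zc p q) := by
    intro p q hp hq t ht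
    rw [← hRx_eq p q hp hq]
    rcases Nat.eq_zero_or_pos q with h0 | h0
    · subst h0
      rw [heh_zero]
      show P ∈ Rx p 0
      rw [← hv0 p]
      exact hRxc p 0 _ (hcorner p 0 p 0 (Or.inr rfl) (Or.inr rfl)) (hvK p 0 hp.le (Nat.zero_le N))
    · rw [heh_mid p q h0 hq]; exact ((hEH p q ⟨hp, h0, hq⟩).2.2.2 t ht).2
  have Ht : ∀ p q, p < N → q < N → ∀ t ∈ Icc (0 : ℝ) 1, (eh p (q + 1)).toFun t ∈ Rg (zc p q) := by
    intro p q hp hq t ht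
    rw [← hRx_eq p q hp hq]
    rcases Nat.lt_or_ge (q + 1) N with hq1 | hq1
    · rw [heh_mid p (q + 1) (Nat.succ_pos q) hq1]
      have := ((hEH p (q + 1) ⟨hp, Nat.succ_pos q, hq1⟩).2.2.2 t ht).1
      rwa [Nat.add_sub_cancel] at this
    · rw [heh_N p (q + 1) (Nat.succ_ne_zero q) hq1]
      show Q ∈ Rx p q
      have hqN : q = N - 1 := by omega
      rw [← hvN p, hqN]
      exact hRxc p (N - 1) _ (hcorner p N p (N - 1) (Or.inr rfl) (Or.inl rfl)) (hvK p N hp.le le_rfl)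
  have Hl : ∀ p q, p < N → q < N → ∀ t ∈ Icc (0 : ℝ) 1, (ev p q).toFun t ∈ Rg (zc p q) := by
    intro p q hp hq t ht
    rw [← hRx_eq p q hp hq]
    rcases Nat.eq_zero_or_pos p with h0 | h0
    · subst h0
      rw [hev_zero, CurvePath.gridPiece_apply _ _ _ _ hq, hγ₀ _ (div_add_div_mem_Icc hN hq ht)]
      refine hRxc 0 q _ ⟨⟨?_, ?_⟩, ?_, ?_⟩ ⟨hI0, div_add_div_mem_Icc hN hq ht⟩
      · rw [Nat.cast_zero, zero_div]
      · positivity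
      · have : 0 ≤ t / N := div_nonneg ht.1 hN'.le
        linarith
      · rw [← add_div]; exact div_le_div_of_nonneg_right (by linarith [ht.2]) hN'.le
    · rw [hev_mid p q h0 hp]; exact ((hEV p q ⟨h0, hp, hq⟩).2.2.2 t ht).2
  have Hr : ∀ p q, p < N → q < N → ∀ t ∈ Icc (0 : ℝ) 1, (ev (p + 1) q).toFun t ∈ Rg (zc p q) := by
    intro p q hp hq t ht
    rw [← hRx_eq p q hp hq]
    rcases Nat.lt_or_ge (p + 1) N with hp1 | hp1
    · rw [hev_mid (p + 1) q (Nat.succ_pos p) hp1]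
      have := ((hEV (p + 1) q ⟨Nat.succ_pos p, hp1, hq⟩).2.2.2 t ht).1
      rwa [Nat.add_sub_cancel] at this
    · have hpN : p + 1 = N := le_antisymm hp hp1
      rw [hpN, hev_N, CurvePath.gridPiece_apply _ _ _ _ hq, hγ₁ _ (div_add_div_mem_Icc hN hq ht)]
      refine hRxc p q _ ⟨⟨?_, ?_⟩, ?_, ?_⟩ ⟨hI1, div_add_div_mem_Icc hN hq ht⟩
      · rw [div_le_one hN']; exact_mod_cast hp.le
      · rw [← Nat.cast_add_one, hpN, div_self hN'.ne']
      · have : 0 ≤ t / N := div_nonneg ht.1 hN'.le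
        linarith
      · rw [← add_div]; exact div_le_div_of_nonneg_right (by linarith [ht.2]) hN'.le
  -- Step 7: the chart cell of every cell of the grid
  have hcellrel : ∀ p q, p < N → q < N →
      KZ.of (Rh p q) + KZ.of (Rv (p + 1) q) - KZ.of (Rh p (q + 1)) - KZ.of (Rv p q) ∈ M₁ := by
    intro p q hp hq
    have hz₀ : zc p q ∈ Z.points := (hgrid p q hp hq).1
    obtain ⟨hb1, hb2, hb3, hb4⟩ := cell_inputs (ρ := ρc (zc p q)) (h1c _ hz₀) (eh p q)
      (hsah p q hp hq.le) (Hb p q hp hq) (hRh p q ⟨hp, hq.le⟩)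
    obtain ⟨hr1, hr2, hr3, hr4⟩ := cell_inputs (ρ := ρc (zc p q)) (h1c _ hz₀) (ev (p + 1) q)
      (hsav (p + 1) q hp hq) (Hr p q hp hq) (hRv (p + 1) q ⟨hp, hq⟩)
    obtain ⟨ht1, ht2, ht3, ht4⟩ := cell_inputs (ρ := ρc (zc p q)) (h1c _ hz₀) (eh p (q + 1))
      (hsah p (q + 1) hp hq) (Ht p q hp hq) (hRh p (q + 1) ⟨hp, hq⟩)
    obtain ⟨hl1, hl2, hl3, hl4⟩ := cell_inputs (ρ := ρc (zc p q)) (h1c _ hz₀) (ev p q)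
      (hsav p q hp.le hq) (Hl p q hp hq) (hRv p q ⟨hp.le, hq⟩)
    refine hCell Z.n ω hω a ha (cc (zc p q)) (εc (zc p q)) (ρc (zc p q)) (ψc (zc p q))
      (hρc _ hz₀) (hρε _ hz₀) (hψan _ hz₀) (hψsa _ hz₀)
      (fun t => (eh p q).toFun t (ι (zc p q))) (fun t => (ev (p + 1) q).toFun t (ι (zc p q)))
      (fun t => (eh p (q + 1)).toFun t (ι (zc p q))) (fun t => (ev p q).toFun t (ι (zc p q)))
      hb1 hr1 ht1 hl1 hb2 hr2 ht2 hl2 hb3 hr3 ht3 hl3 ?_ ?_ ?_ ?_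
      (Rh p q) (Rv (p + 1) q) (Rh p (q + 1)) (Rv p q) hb4 hr4 ht4 hl4
    · show (eh p q).toFun 0 (ι (zc p q)) = (ev p q).toFun 0 (ι (zc p q))
      rw [Heh0 p q hp hq.le, Hev0 p q hp.le hq]
    · show (eh p q).toFun 1 (ι (zc p q)) = (ev (p + 1) q).toFun 0 (ι (zc p q))
      rw [Heh1 p q hp hq.le, Hev0 (p + 1) q hp hq]
    · show (ev (p + 1) q).toFun 1 (ι (zc p q)) = (eh p (q + 1)).toFun 1 (ι (zc p q))
      rw [Hev1 (p + 1) q hp hq, Heh1 p (q + 1) hp hq]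
    · show (ev p q).toFun 1 (ι (zc p q)) = (eh p (q + 1)).toFun 0 (ι (zc p q))
      rw [Hev1 p q hp.le hq, Heh0 p (q + 1) hp hq]
  -- Step 8: telescoping; the bottom and top rows are constant
  have Hbot : ∀ p, p < N → KZ.of (Rh p 0) ∈ M₁ := fun p hp => by
    have h := hRh p 0 ⟨hp, Nat.zero_le N⟩
    rw [heh_zero] at h
    exact of_mem_of_realisesRep_const (e := cP.toFun) (P := P) (fun _ => rfl) h
  have Htop : ∀ p, p < N → KZ.of (Rh p N) ∈ M₁ := fun p hp => by
    have h := hRh p N ⟨hp, le_rfl⟩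
    rw [heh_N p N hN.ne' le_rfl] at h
    exact of_mem_of_realisesRep_const (e := cQ.toFun) (P := Q) (fun _ => rfl) h
  have hsides := telescope_mem (fun p q => KZ.of (Rh p q)) (fun p q => KZ.of (Rv p q)) N hcellrel Hbot Htop
  -- Step 9: the two sides are the sums of the grid pieces of `γ₀`, `γ₁`
  have h₀ : KZ.of r₀ - ∑ q ∈ Finset.range N, KZ.of (Rv 0 q) ∈ M₁ := by
    refine of_sub_sum_pieces_mem ω a γ₀.contDiffOn hN r₀ hr₀ (fun q => Rv 0 q) fun q hq => ?_
    have h := hRv 0 q ⟨Nat.zero_le N, hq⟩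
    rw [hev_zero, hpiece₀ q hq] at h
    exact h
  have h₁ : KZ.of r₁ - ∑ q ∈ Finset.range N, KZ.of (Rv N q) ∈ M₁ := by
    refine of_sub_sum_pieces_mem ω a γ₁.contDiffOn hN r₁ hr₁ (fun q => Rv N q) fun q hq => ?_
    have h := hRv N q ⟨le_rfl, hq⟩
    rw [hev_N, hpiece₁ q hq] at h
    exact h
  have := M₁.sub_mem (M₁.sub_mem h₀ h₁) hsides
  convert this using 1
  abel

/-- **Homotopy invariance of real realisations, unconditionally** (registered anchor `homotopyInvariance_holds`):
`stub_homotopyInvariance` with its inputs discharged by the landed stubs. [cite: HuberWustholz2022, §3.3.1] -/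
theorem homotopyInvariance_holds : ∀ (Z : CurveData) (hZ : Z.IsSmoothAffineCurve) (ω : Fin Z.n → MvPolynomial (Fin Z.n) ℂ), (∀ i, HasAlgCoeffs (ω i)) → ∀ (a : ℂ), IsAlgebraic ℚ a → ∀ (γ₀ γ₁ : CurvePath Z), IsSemialgebraicMapOn ℚ {z : Fin 1 → ℝ | z 0 ∈ Set.Icc (0 : ℝ) 1} (fun z => Fin.append (fun i => (γ₀.toFun (z 0) i).re) (fun i => (γ₀.toFun (z 0) i).im)) → IsSemialgebraicMapOn ℚ {z : Fin 1 → ℝ | z 0 ∈ Set.Icc (0 : ℝ) 1} (fun z => Fin.append (fun i => (γ₁.toFun (z 0) i).re) (fun i => (γ₁.toFun (z 0) i).im)) → (∃ (x y : Z.points) (p₀ p₁ : Path x y), (∀ t : I, γ₀.toFun t = p₀ t) ∧ (∀ t : I, γ₁.toFun t = p₁ t) ∧ p₀.Homotopic p₁) → ∀ (r₀ r₁ : KZ.IntegralRep 1), (r₀.domain = {z | z 0 ∈ Set.Ioo (0 : ℝ) 1} ∧ ∀ z ∈ r₀.domain, r₀.integrand z = (a * ∑ i, MvPolynomial.eval (γ₀.toFun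 (z 0)) (ω i) * deriv (fun u => γ₀.toFun u i) (z 0)).re) → (r₁.domain = {z | z 0 ∈ Set.Ioo (0 : ℝ) 1} ∧ ∀ z ∈ r₁.domain, r₁.integrand z = (a * ∑ i, MvPolynomial.eval (γ₁.toFun (z 0)) (ω i) * deriv (fun u => γ₁.toFun u i) (z 0)).re) → KZ.of r₀ - KZ.of r₁ ∈ M₁ :=
  stub_homotopyInvariance stub_saChart (stub_saPathSubset stub_saChart) (stub_cellGreen stub_greenOnSquare)

end Summit.KontsevichZagierPeriods.SymplecticScissors.RealOnePeriodRelations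

end
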